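import Summits.QuantumFields.BalabanUV.T4Continuum.Support.NE7MarginalL1Runs
import Summits.QuantumFields.BalabanUV.T4Continuum.Support.NE7MarginalL1Currency
import Summits.QuantumFields.BalabanUV.T4Continuum.Support.NE7PairwiseCouplingDock

/-!
# NE7PairwiseL1Junction — row NE7 (node U5), the junction «ℓ¹ ⟹ null» BY NAME: route ℓ¹'s RUN-side output
# (CONSECUTIVE coupling discrepancies SMEAR- or TAIL-dominated by one summable sequence, `NE7MarginalL1Runs`) feeds
# route «PAIR-CAUCHY»'s marginal channel (the PAIRWISE coupling gap is null, uniformly in the finer run) by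
# telescoping over the runs — and, at the level of β-shifts, ℓ¹ consecutive shifts give the dock's n-uniform (σ)
# while merely NULL consecutive shifts do not

Cell `pub-balaban`, rung (B)+1 sub-cell t4, lineage `b2b-balaban-t4-ne7-p2` (CRUX PROVER NE7 #2 under the coordinator
ruling «YM redirect» e34b3e0c, 2026-08-21; generation 59; route text `HOME/t4/b2b-balaban-t4-ne7-p2/g59/ROUTE2-NE7-P2.md`
v1.13 §2 T.5♭ ∕ §16).  HONEST FRAMING (page 1): FIXED FINITE T⁴, rung (B)+1 = existence AND uniqueness of the
`ε = L^{−K} → 0` limit of unit-scale averaged expectations, CONDITIONAL on BetaPertH and the nine spine estimates (0/9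
proved); NOT infinite volume, NOT a mass gap, NOT the Clay problem.  NE7 is NOT PRINTED in
[Balaban1984PropagatorsI]–[Balaban1989LargeFieldII] and NOT proved here.  Everything below is [folklore] real analysis
over the tree's hypothesis SHAPES (`T4CouplingMatching.disc`, `NE7MarginalL1Currency.SmearDominated` ∕ `TailDominated`,
`FlowStep.Box` ∕ `prefixOf`); 0 definitions, no cite tag of our own, nothing printed asserted, no `sorry`.

WHY.  Route ℓ¹ (rank 1 → t4-ne7-p1; `NE7MarginalL1Currency` p272763, `NE7MarginalL1Runs`, `NE7MarginalL1Supply`)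
re-denominates the marginal channel in the ℓ¹ currency: along a family `K ↦ g K` of IR-pinned runs of (0.20) the
CONSECUTIVE discrepancy `disc (g K) (g (K+1)) j = |1∕(g K j)² − 1∕(g (K+1) (j+1))²|` is dominated by the ω-smeared tail
of ONE nonnegative sequence `σ` (`NE7MarginalL1Runs.disc_runs_le_smear_fadingMemory`: `≤ 2·Σ_{l<K} σ_l ω^{(j−l)₊}`, the
shape `SmearDominated 2 ω σ`; last-only feedback: `disc_runs_le_tail_lastOnly`, the shape `TailDominated`), and node U6
follows from `Σσ < ∞`.  Route «PAIR-CAUCHY» (this lineage; `NE7PairwiseCouplingDock.couplingGap_tendsto_zero` p249585,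
`NE7PairwiseCouplingUniform.couplingGap_uniform` p250419) consumes the marginal channel in the NULL currency: for every
block scale `m` and every finer run `K + n K`, the PAIRWISE gap `|1∕(g K (K−m))² − 1∕(g (K+n K) (K−m+n K))²| → 0`
(NODE T♭'s input `hd` in `NE7PairwiseTower.termModulus_tendsto_zero`).  This file is the junction BY NAME: route ℓ¹'s
output ⟹ route «PAIR-CAUCHY»'s input, by TELESCOPING OVER THE RUNS `K, K+1, …, K+n` (§1) — legitimate precisely in the
ℓ¹ currency (ROUTE2 §5 (F-tel): «telescoping re-imports summability» — here the currency IS the summability) — and the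
n-FREE majorant `M·(Σ_{j ≥ K−m} (σ⋆ω)_j + m·Σ_{l ≥ K−m} σ_l)` (§2: the tail of the Cauchy product of `σ` with the geometric
sequence plus `m` tails of `σ`; both null because both series converge).  §4 records the same junction one level up, at
the β-shifts: consecutive shifts bounded ON THE BOXES by a SUMMABLE `σ_k` (the shape of `T4CouplingMatching.ScaleShiftRate`
with `cθ^k ↦ σ_k`) give the dock's n-uniform scale-shift modulus (σ) with modulus `Σ_{i ≥ k} σ_i → 0`
(`NE7PairwiseScaleShift` §1 is the geometric case), hence the dock's conclusion under its other binders; and the CONTRAST: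
consecutive shifts that are merely NULL (`1∕(k+1)`, the harmonic β) admit NO n-uniform modulus at all — (σ) is a genuinely
two-run ask, implied by ℓ¹ and not by «consecutive → 0».  (Route ℓ¹'s own supplier shape `ShiftAlongRun` bounds the
consecutive shift along run B's TRUE prefixes only; the n-layer shift telescopes through TRUNCATED histories, which are not
prefixes — which is why the junction of §§1–3 runs through the coupling gaps, where route ℓ¹'s run side has already
consumed the history.)

WHAT IS PROVED ([folklore]).
§1 `gap_le_sum_disc` — `|x^K_{K−m} − x^{K+n}_{K−m+n}| ≤ Σ_{i<n} disc (g (K+i)) (g (K+i+1)) (K−m+i)` (telescoping over runs).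
§2 `smear_le_conv_add_window` (one smear ≤ the Cauchy-product term + a window of `m` shifts), **`sum_smear_le_l1Tail`**
   (the n-free majorant), `tendsto_l1Tail` (it is null in `K` at fixed `m`).
§3 **`couplingGap_le_of_smearDominated`**, **`couplingGap_tendsto_zero_of_smearDominated`** (the dock's conclusion shape,
   every offset sequence), **`couplingGap_uniform_of_smearDominated`** (p250419's conclusion shape, directly — no diagonal
   argument), `…_of_tailDominated`; BY NAME from route ℓ¹'s run side: **`couplingGap_tendsto_zero_of_shiftAlong_fadingMemory`**,
   `couplingGap_uniform_of_shiftAlong_fadingMemory`, `couplingGap_tendsto_zero_of_shiftAlong_lastOnly`.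
§4 `nullShift_sum_of_boxShift`, **`nullShift_of_summableShift`** ((σ) with modulus `Σ_{i≥k} σ_i`), `tendsto_l1Shift`,
   **`couplingGap_tendsto_zero_of_summableShift`** (the dock under ℓ¹ box shifts), and the contrast
   **`no_nLayerModulus_of_harmonicShift`** (consecutive shifts `= 1∕(k+1) → 0`, yet no `σ k` bounds the n-layer shift).

NOT DELIVERED: `σ` itself (route ℓ¹'s SUPPLIER side `NE7MarginalL1Supply` produces a summable `σ` from its OWN unprinted
hypotheses — data renewal, memory; cell wall (γ2)∕(γ3)); nothing about [Balaban1987RG1]'s (1.22); no input of either route is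
removed by name.  NOT NE7 (spine 0/9 unchanged), NOT summit progress.  HONEST DEPENDENCY: continuum YM on T⁴ ⇐ BetaPertH ∧
nine spine estimates (0/9 proved); BetaPertH ⇐ (D1) ∧ (D4) ∧ CAP+tail; G-an2-4 gates asym, D1 and NE2/3/4.
-/

noncomputable section

open Finset Filter Topology
open scoped BigOperators

namespace Summit.QuantumFields.BalabanUV.T4Continuum.NE7PairwiseL1Junction

open Literature.MathematicalPhysics.QuantumFieldTheory.Balaban1983to89
open Literature.MathematicalPhysics.QuantumFieldTheory.Balaban1983to89.FlowStep
open Literature.MathematicalPhysics.QuantumFieldTheory.Balaban1983to89.T4CouplingMatching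
open NE7MarginalL1Currency (smear SmearDominated TailDominated)

/-! ## §1 Telescoping over the runs -/

/-- **TELESCOPING OVER THE RUNS.**  For a family of runs `g`, a block scale `m` and an offset `n`: the pairwise gap in
`x = 1∕g²` between run `K` at scale `K − m` and run `K + n` at the infrared-matched scale `K − m + n` is at most the sum of
the `n` CONSECUTIVE discrepancies met on the way, `Σ_{i<n} disc (g (K+i)) (g (K+i+1)) (K−m+i)`. [folklore] -/
theorem gap_le_sum_disc (g : ℕ → ℕ → ℝ) (K m : ℕ) :
    ∀ n, |1 / (g K (K - m)) ^ 2 - 1 / (g (K + n) (K - m + n)) ^ 2|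
      ≤ ∑ i ∈ range n, disc (g (K + i)) (g (K + i + 1)) (K - m + i) := by
  intro n
  induction n with
  | zero => simp
  | succ n ih =>
    rw [sum_range_succ]
    have e1 : K + (n + 1) = K + n + 1 := rfl
    have e2 : K - m + (n + 1) = K - m + n + 1 := rfl
    have hd : disc (g (K + n)) (g (K + n + 1)) (K - m + n)
        = |1 / (g (K + n) (K - m + n)) ^ 2 - 1 / (g (K + n + 1) (K - m + n + 1)) ^ 2| := rfl
    rw [e1, e2, hd]
    exact (abs_sub_le _ (1 / (g (K + n) (K - m + n)) ^ 2) _).trans (add_le_add ih le_rfl)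

/-! ## §2 The n-free ℓ¹ majorant of the smeared tails met on the way -/

/-- ONE SMEAR ≤ CAUCHY-PRODUCT TERM + A WINDOW OF `m` SHIFTS.  For `σ ≥ 0`, `ω ≥ 0` and `K′ ≤ j + m`:
`smear ω σ K′ j = Σ_{l<K′} σ_l ω^{(j−l)₊} ≤ Σ_{l≤j} σ_l ω^{j−l} + Σ_{t<m} σ_{j+1+t}` — the scales older than `j` carry the
geometric weight (the Cauchy-product term `smear ω σ (j+1) j`), the at most `m` younger ones weight `1`. [folklore] -/
theorem smear_le_conv_add_window {ω : ℝ} {σ : ℕ → ℝ} (hω : 0 ≤ ω) (hσ : ∀ i, 0 ≤ σ i) {K' j m : ℕ}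
    (h : K' ≤ j + m) :
    smear ω σ K' j ≤ smear ω σ (j + 1) j + ∑ t ∈ range m, σ (j + 1 + t) := by
  unfold smear
  have hnn : ∀ l, 0 ≤ σ l * ω ^ (j - l) := fun l => mul_nonneg (hσ l) (pow_nonneg hω _)
  calc ∑ l ∈ range K', σ l * ω ^ (j - l)
      ≤ ∑ l ∈ range (j + 1 + m), σ l * ω ^ (j - l) :=
        sum_le_sum_of_subset_of_nonneg (range_subset_range.mpr (by omega)) fun l _ _ => hnn l
    _ = ∑ l ∈ range (j + 1), σ l * ω ^ (j - l) + ∑ l ∈ Ico (j + 1) (j + 1 + m), σ l * ω ^ (j - l) :=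
        (sum_range_add_sum_Ico _ (Nat.le_add_right _ _)).symm
    _ = ∑ l ∈ range (j + 1), σ l * ω ^ (j - l) + ∑ t ∈ range m, σ (j + 1 + t) := by
        congr 1
        rw [sum_Ico_eq_sum_range, show j + 1 + m - (j + 1) = m by omega]
        refine sum_congr rfl fun t _ => ?_
        rw [show j - (j + 1 + t) = 0 by omega, pow_zero, mul_one]

/-- **THE n-FREE MAJORANT.**  For `σ ≥ 0` summable and `0 ≤ ω < 1`: the smeared tails met while telescoping from run `K`
to run `K + n` at block scale `m` sum to at most
`Σ'_k smear ω σ (k + (K−m) + 1) (k + (K−m)) + m·Σ'_k σ (k + (K−m))` — the TAIL beyond `K − m` of the Cauchy product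
`j ↦ Σ_{l≤j} σ_l ω^{j−l}` (summable: `NE7MarginalL1Currency.summable_conv_geometric`) plus `m` TAILS of `σ` — a bound
independent of `n`. [folklore] -/
theorem sum_smear_le_l1Tail {ω : ℝ} {σ : ℕ → ℝ} (hω0 : 0 ≤ ω) (hω1 : ω < 1) (hσ : ∀ i, 0 ≤ σ i)
    (hs : Summable σ) (K m n : ℕ) :
    ∑ i ∈ range n, smear ω σ (K + i) (K - m + i)
      ≤ ∑' k, smear ω σ (k + (K - m) + 1) (k + (K - m)) + m * ∑' k, σ (k + (K - m)) := by
  set a := K - m with ha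
  have hKa : K ≤ a + m := by omega
  have hconv : Summable (fun j => smear ω σ (j + 1) j) := by
    simp only [smear]
    exact NE7MarginalL1Currency.summable_conv_geometric hs hσ hω0 hω1
  have hconv_a : Summable (fun k => smear ω σ (k + a + 1) (k + a)) :=
    (summable_nat_add_iff (f := fun j => smear ω σ (j + 1) j) a).mpr hconv
  have hσ_a : Summable (fun k => σ (k + a)) := (summable_nat_add_iff (f := σ) a).mpr hs
  -- pointwise: one smear ≤ Cauchy-product term + window
  have hpt : ∀ i ∈ range n,
      smear ω σ (K + i) (a + i) ≤ smear ω σ (i + a + 1) (i + a) + ∑ t ∈ range m, σ ((i + (t + 1)) + a) := by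
    intro i _
    have h := smear_le_conv_add_window (σ := σ) hω0 hσ (K' := K + i) (j := a + i) (m := m) (by omega)
    rw [show a + i = i + a by ring] at h ⊢
    refine h.trans (add_le_add le_rfl (le_of_eq (sum_congr rfl fun t _ => ?_)))
    rw [show i + a + 1 + t = i + (t + 1) + a by ring]
  -- each window row is a tail of `σ` beyond `a`
  have hrow : ∀ t ∈ range m, ∑ i ∈ range n, σ ((i + (t + 1)) + a) ≤ ∑' k, σ (k + a) := by
    intro t _
    have hshift : Summable (fun i => σ ((i + (t + 1)) + a)) :=
      (summable_nat_add_iff (f := fun k => σ (k + a)) (t + 1)).mpr hσ_a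
    have h1 : ∑ i ∈ range n, σ ((i + (t + 1)) + a) ≤ ∑' i, σ ((i + (t + 1)) + a) :=
      hshift.sum_le_tsum (range n) fun i _ => hσ _
    have h2 : ∑ i ∈ range (t + 1), σ (i + a) + ∑' i, σ ((i + (t + 1)) + a) = ∑' k, σ (k + a) :=
      hσ_a.sum_add_tsum_nat_add (t + 1)
    have h3 : 0 ≤ ∑ i ∈ range (t + 1), σ (i + a) := sum_nonneg fun i _ => hσ _
    linarith
  calc ∑ i ∈ range n, smear ω σ (K + i) (a + i)
      ≤ ∑ i ∈ range n, (smear ω σ (i + a + 1) (i + a) + ∑ t ∈ range m, σ ((i + (t + 1)) + a)) := sum_le_sum hpt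
    _ = ∑ i ∈ range n, smear ω σ (i + a + 1) (i + a)
          + ∑ t ∈ range m, ∑ i ∈ range n, σ ((i + (t + 1)) + a) := by rw [sum_add_distrib, sum_comm]
    _ ≤ ∑' k, smear ω σ (k + a + 1) (k + a) + ∑ t ∈ range m, ∑' k, σ (k + a) :=
        add_le_add (hconv_a.sum_le_tsum (range n) fun k _ => NE7MarginalL1Currency.smear_nonneg hω0 hσ _ _)
          (sum_le_sum hrow)
    _ = ∑' k, smear ω σ (k + a + 1) (k + a) + m * ∑' k, σ (k + a) := by
        rw [sum_const, card_range, nsmul_eq_mul]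

/-- The majorant is NULL in `K` at fixed `m`: tails of convergent series (`tendsto_sum_nat_add`) composed with
`K ↦ K − m → ∞`. [folklore] -/
theorem tendsto_l1Tail {ω : ℝ} (σ : ℕ → ℝ) (m : ℕ) :
    Tendsto (fun K => ∑' k, smear ω σ (k + (K - m) + 1) (k + (K - m)) + m * ∑' k, σ (k + (K - m)))
      atTop (𝓝 0) := by
  have h1 : Tendsto (fun K => ∑' k, smear ω σ (k + (K - m) + 1) (k + (K - m))) atTop (𝓝 0) :=
    (tendsto_sum_nat_add (fun j => smear ω σ (j + 1) j)).comp (tendsto_sub_atTop_nat m)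
  have h2 : Tendsto (fun K => ∑' k, σ (k + (K - m))) atTop (𝓝 0) :=
    (tendsto_sum_nat_add σ).comp (tendsto_sub_atTop_nat m)
  simpa using h1.add (h2.const_mul (m : ℝ))

/-! ## §3 The junction: SMEAR-∕TAIL-dominated consecutive discrepancies ⟹ the pairwise gap is null, n-uniformly -/

/-- **THE n-FREE BOUND ON THE PAIRWISE COUPLING GAP.**  If the consecutive discrepancies of the family `g` are
smear-dominated, `SmearDominated M ω σ (K j ↦ disc (g K) (g (K+1)) j)` (route ℓ¹'s run-side output shape), with `σ ≥ 0`
summable, `0 ≤ ω < 1`, `0 ≤ M`, then for all `K, m, n`: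
`|1∕(g K (K−m))² − 1∕(g (K+n) (K−m+n))²| ≤ M·(Σ'_k smear ω σ (k+(K−m)+1) (k+(K−m)) + m·Σ'_k σ (k+(K−m)))`. [folklore] -/
theorem couplingGap_le_of_smearDominated {M ω : ℝ} {σ : ℕ → ℝ} {g : ℕ → ℕ → ℝ}
    (hω0 : 0 ≤ ω) (hω1 : ω < 1) (hM : 0 ≤ M) (hσ : ∀ i, 0 ≤ σ i) (hs : Summable σ)
    (hdom : SmearDominated M ω σ (fun K j => disc (g K) (g (K + 1)) j)) (K m n : ℕ) :
    |1 / (g K (K - m)) ^ 2 - 1 / (g (K + n) (K - m + n)) ^ 2|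
      ≤ M * (∑' k, smear ω σ (k + (K - m) + 1) (k + (K - m)) + m * ∑' k, σ (k + (K - m))) := by
  refine (gap_le_sum_disc g K m n).trans ?_
  calc ∑ i ∈ range n, disc (g (K + i)) (g (K + i + 1)) (K - m + i)
      ≤ ∑ i ∈ range n, M * smear ω σ (K + i) (K - m + i) :=
        sum_le_sum fun i _ => (hdom (K + i) (K - m + i) (by omega)).2
    _ = M * ∑ i ∈ range n, smear ω σ (K + i) (K - m + i) := by rw [mul_sum]
    _ ≤ _ := mul_le_mul_of_nonneg_left (sum_smear_le_l1Tail hω0 hω1 hσ hs K m n) hM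

/-- **«ℓ¹ ⟹ NULL» IN THE MARGINAL CHANNEL — THE DOCK's CONCLUSION SHAPE.**  Under `SmearDominated M ω σ` of the
consecutive discrepancies with `Σσ < ∞`: for EVERY offset sequence `n` and every block scale `m`,
`|1∕(g K (K−m))² − 1∕(g (K+n K) (K−m+n K))²| → 0` as `K → ∞` — the conclusion of
`NE7PairwiseCouplingDock.couplingGap_tendsto_zero` (p249585), i.e. NODE T♭'s marginal input `hd`, obtained here from
route ℓ¹'s currency instead of the n-layer modulus (σ). [folklore] -/
theorem couplingGap_tendsto_zero_of_smearDominated {M ω : ℝ} {σ : ℕ → ℝ} {g : ℕ → ℕ → ℝ}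
    (hω0 : 0 ≤ ω) (hω1 : ω < 1) (hM : 0 ≤ M) (hσ : ∀ i, 0 ≤ σ i) (hs : Summable σ)
    (hdom : SmearDominated M ω σ (fun K j => disc (g K) (g (K + 1)) j)) (n : ℕ → ℕ) :
    ∀ m, Tendsto (fun K => |1 / (g K (K - m)) ^ 2 - 1 / (g (K + n K) (K - m + n K)) ^ 2|) atTop (𝓝 0) := by
  intro m
  refine squeeze_zero (fun K => abs_nonneg _)
    (fun K => couplingGap_le_of_smearDominated hω0 hω1 hM hσ hs hdom K m (n K)) ?_
  simpa using (tendsto_l1Tail (ω := ω) σ m).const_mul M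

/-- **THE PAIRWISE-UNIFORM FORM, DIRECTLY** (the conclusion shape of `NE7PairwiseCouplingUniform.couplingGap_uniform`,
p250419 — here WITHOUT the diagonal argument, because the ℓ¹ majorant is already n-free): for every `m` and `ε > 0` there
is `K₀` with `|1∕(g K (K−m))² − 1∕(g K′ (K′−m))²| < ε` for all `K₀ ≤ K ≤ K′`. [folklore] -/
theorem couplingGap_uniform_of_smearDominated {M ω : ℝ} {σ : ℕ → ℝ} {g : ℕ → ℕ → ℝ}
    (hω0 : 0 ≤ ω) (hω1 : ω < 1) (hM : 0 ≤ M) (hσ : ∀ i, 0 ≤ σ i) (hs : Summable σ)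
    (hdom : SmearDominated M ω σ (fun K j => disc (g K) (g (K + 1)) j)) :
    ∀ m : ℕ, ∀ ε : ℝ, 0 < ε → ∃ K₀ : ℕ, ∀ K K' : ℕ, K₀ ≤ K → K ≤ K' →
      |1 / (g K (K - m)) ^ 2 - 1 / (g K' (K' - m)) ^ 2| < ε := by
  intro m ε hε
  have ht : Tendsto (fun K => M * (∑' k, smear ω σ (k + (K - m) + 1) (k + (K - m))
      + m * ∑' k, σ (k + (K - m)))) atTop (𝓝 0) := by
    simpa using (tendsto_l1Tail (ω := ω) σ m).const_mul M
  obtain ⟨K₀, hK₀⟩ := (Metric.tendsto_atTop.mp ht) ε hε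
  refine ⟨max K₀ m, fun K K' hK hKK' => ?_⟩
  have hK0 : K₀ ≤ K := le_trans (le_max_left _ _) hK
  have hmK : m ≤ K := le_trans (le_max_right _ _) hK
  have h := couplingGap_le_of_smearDominated hω0 hω1 hM hσ hs hdom K m (K' - K)
  have e1 : K + (K' - K) = K' := by omega
  have e2 : K - m + (K' - K) = K' - m := by omega
  rw [e1, e2] at h
  have h2 := hK₀ K hK0
  rw [Real.dist_eq, sub_zero] at h2
  exact lt_of_le_of_lt h (lt_of_abs_lt h2)

/-- The TAIL-dominated case (last-only feedback; route ℓ¹'s `TailDominated M σ`): a tail is a smear with `ω = 0`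
(`NE7MarginalL1Currency.TailDominated.smearDominated`), so the same conclusion holds for every offset sequence. [folklore] -/
theorem couplingGap_tendsto_zero_of_tailDominated {M : ℝ} {σ : ℕ → ℝ} {g : ℕ → ℕ → ℝ}
    (hM : 0 ≤ M) (hσ : ∀ i, 0 ≤ σ i) (hs : Summable σ)
    (hdom : TailDominated M σ (fun K j => disc (g K) (g (K + 1)) j)) (n : ℕ → ℕ) :
    ∀ m, Tendsto (fun K => |1 / (g K (K - m)) ^ 2 - 1 / (g (K + n K) (K - m + n K)) ^ 2|) atTop (𝓝 0) :=
  couplingGap_tendsto_zero_of_smearDominated le_rfl zero_lt_one hM hσ hs (hdom.smearDominated hM le_rfl hσ) n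

/-- **BY NAME FROM ROUTE ℓ¹'s RUN SIDE (GENUINE FADING MEMORY).**  Under the binders of
`NE7MarginalL1Runs.disc_runs_le_smear_fadingMemory` VERBATIM (IR-pinned eventually-AF runs of (0.20) in the box,
`HistLipschitz Λ γ β`, `FadingMemory C ω Λ` with `0 < ω < 1`, `EventualLowerH b γ k₀ β`, the smallness
`C((k₀+1)γ³ + 2γ∕b) ≤ (1−ω)∕2`, the β-shift bounded by `σ j` ALONG every run `g (K+1)`) PLUS route ℓ¹'s currency `Σσ < ∞`:
for every offset sequence `n` and block scale `m`, `|1∕(g K (K−m))² − 1∕(g (K+n K) (K−m+n K))²| → 0` — route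
«PAIR-CAUCHY»'s leaf T.5♭ conclusion from route ℓ¹'s inputs.  Every hypothesis on `β` is an UNPRINTED input (cell NE4 ∕
NE9 ∕ (γ2)–(γ3)); bookkeeping. [folklore] -/
theorem couplingGap_tendsto_zero_of_shiftAlong_fadingMemory {β : HBeta} {γ b ω C : ℝ} {Λ : ℕ → ℕ → ℝ} {σ : ℕ → ℝ}
    {k₀ : ℕ} (g : ℕ → ℕ → ℝ) (gIR : ℝ) (n : ℕ → ℕ)
    (hγ : 0 < γ) (hb : 0 < b) (hω0 : 0 < ω) (hω1 : ω < 1) (hC : 0 ≤ C) (hσ0 : ∀ j, 0 ≤ σ j)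
    (hs : Summable σ)
    (hrun : ∀ K, RGEqH K β (g K)) (hbox : ∀ K i, i ≤ K → 0 < g K i ∧ g K i ≤ γ) (hpin : ∀ K, g K K = gIR)
    (hS : ∀ K j, j < K →
      |β (j + 1) (prefixOf (g (K + 1)) (j + 1)) - β j (Fin.tail (prefixOf (g (K + 1)) (j + 1)))| ≤ σ j)
    (hL : HistLipschitz Λ γ β) (hΛ : FadingMemory C ω Λ) (hlo : EventualLowerH b γ k₀ β)
    (hsmall : C * (((k₀ : ℝ) + 1) * γ ^ 3 + 2 * γ / b) ≤ (1 - ω) / 2) :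
    ∀ m, Tendsto (fun K => |1 / (g K (K - m)) ^ 2 - 1 / (g (K + n K) (K - m + n K)) ^ 2|) atTop (𝓝 0) :=
  couplingGap_tendsto_zero_of_smearDominated hω0.le hω1 (by norm_num : (0 : ℝ) ≤ 2) hσ0 hs
    (NE7MarginalL1Runs.disc_runs_le_smear_fadingMemory g gIR hγ hb hω0 hω1 hC hσ0 hrun hbox hpin hS hL hΛ hlo
      hsmall) n

/-- The same, PAIRWISE-UNIFORM form (the conclusion shape of `NE7PairwiseCouplingUniform.couplingGap_uniform`), from
route ℓ¹'s fading-memory run side + `Σσ < ∞`.  Bookkeeping over UNPRINTED inputs. [folklore] -/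
theorem couplingGap_uniform_of_shiftAlong_fadingMemory {β : HBeta} {γ b ω C : ℝ} {Λ : ℕ → ℕ → ℝ} {σ : ℕ → ℝ}
    {k₀ : ℕ} (g : ℕ → ℕ → ℝ) (gIR : ℝ)
    (hγ : 0 < γ) (hb : 0 < b) (hω0 : 0 < ω) (hω1 : ω < 1) (hC : 0 ≤ C) (hσ0 : ∀ j, 0 ≤ σ j)
    (hs : Summable σ)
    (hrun : ∀ K, RGEqH K β (g K)) (hbox : ∀ K i, i ≤ K → 0 < g K i ∧ g K i ≤ γ) (hpin : ∀ K, g K K = gIR)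
    (hS : ∀ K j, j < K →
      |β (j + 1) (prefixOf (g (K + 1)) (j + 1)) - β j (Fin.tail (prefixOf (g (K + 1)) (j + 1)))| ≤ σ j)
    (hL : HistLipschitz Λ γ β) (hΛ : FadingMemory C ω Λ) (hlo : EventualLowerH b γ k₀ β)
    (hsmall : C * (((k₀ : ℝ) + 1) * γ ^ 3 + 2 * γ / b) ≤ (1 - ω) / 2) :
    ∀ m : ℕ, ∀ ε : ℝ, 0 < ε → ∃ K₀ : ℕ, ∀ K K' : ℕ, K₀ ≤ K → K ≤ K' →
      |1 / (g K (K - m)) ^ 2 - 1 / (g K' (K' - m)) ^ 2| < ε :=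
  couplingGap_uniform_of_smearDominated hω0.le hω1 (by norm_num : (0 : ℝ) ≤ 2) hσ0 hs
    (NE7MarginalL1Runs.disc_runs_le_smear_fadingMemory g gIR hγ hb hω0 hω1 hC hσ0 hrun hbox hpin hS hL hΛ hlo
      hsmall)

/-- **BY NAME FROM ROUTE ℓ¹'s RUN SIDE (LAST-ONLY FEEDBACK).**  Under the binders of
`NE7MarginalL1Runs.disc_runs_le_tail_lastOnly` VERBATIM (`LastOnlyLipschitz L γ β` with `Lγ³ ≤ 1∕2`, `EventualLowerH`,
shifts bounded along every run `g (K+1)`) PLUS `Σσ < ∞`: the pairwise gap is null for every offset sequence.  Bookkeeping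
over UNPRINTED inputs. [folklore] -/
theorem couplingGap_tendsto_zero_of_shiftAlong_lastOnly {β : HBeta} {γ b L : ℝ} {σ : ℕ → ℝ} {k₀ : ℕ}
    (g : ℕ → ℕ → ℝ) (gIR : ℝ) (n : ℕ → ℕ)
    (hγ : 0 < γ) (hb : 0 < b) (hL0 : 0 ≤ L) (hLγ : L * γ ^ 3 ≤ 1 / 2) (hσ0 : ∀ j, 0 ≤ σ j) (hs : Summable σ)
    (hrun : ∀ K, RGEqH K β (g K)) (hbox : ∀ K i, i ≤ K → 0 < g K i ∧ g K i ≤ γ) (hpin : ∀ K, g K K = gIR)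
    (hS : ∀ K j, j < K →
      |β (j + 1) (prefixOf (g (K + 1)) (j + 1)) - β j (Fin.tail (prefixOf (g (K + 1)) (j + 1)))| ≤ σ j)
    (hLip : LastOnlyLipschitz L γ β) (hlo : EventualLowerH b γ k₀ β) :
    ∀ m, Tendsto (fun K => |1 / (g K (K - m)) ^ 2 - 1 / (g (K + n K) (K - m + n K)) ^ 2|) atTop (𝓝 0) :=
  couplingGap_tendsto_zero_of_tailDominated (Real.exp_pos _).le hσ0 hs
    (NE7MarginalL1Runs.disc_runs_le_tail_lastOnly g gIR hγ hb hL0 hLγ hσ0 hrun hbox hpin hS hLip hlo) n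

/-! ## §4 One level up: ℓ¹ consecutive shifts on the boxes give the dock's (σ); NULL consecutive shifts do not -/

/-- TELESCOPING OVER THE `n` EXTRA LAYERS with a general consecutive modulus: if
`|β (k+1) w − β k (Fin.tail w)| ≤ σ_k` for every `w ∈ ]0,γ]^{k+2}` (the shape of `T4CouplingMatching.ScaleShiftRate` with
`cθ^k ↦ σ_k`), then for all `n, k` and all coupling sequences `w` in the box up to `k + n`,
`|β (k+n) (w_0,…,w_{k+n}) − β k (w_n,…,w_{k+n})| ≤ Σ_{i<n} σ_{k+i}` (`NE7PairwiseScaleShift.nullShift_sum_of_scaleShiftRate`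
is the geometric case). [folklore] -/
theorem nullShift_sum_of_boxShift {β : HBeta} {γ : ℝ} {σ : ℕ → ℝ}
    (hS : ∀ k (w : Fin (k + 2) → ℝ), w ∈ Box γ (k + 1) → |β (k + 1) w - β k (Fin.tail w)| ≤ σ k) :
    ∀ n k (w : ℕ → ℝ), (∀ i, i ≤ k + n → 0 < w i ∧ w i ≤ γ) →
      |β (k + n) (prefixOf w (k + n)) - β k (prefixOf (fun i => w (i + n)) k)|
        ≤ ∑ i ∈ range n, σ (k + i) := by
  intro n
  induction n with
  | zero =>
    intro k w _
    have e : β (k + 0) (prefixOf w (k + 0)) = β k (prefixOf (fun i => w (i + 0)) k) := rfl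
    rw [e, sub_self, abs_zero, sum_range_zero]
  | succ n ih =>
    intro k w hw
    have hbox : prefixOf w (k + n + 1) ∈ Box γ (k + n + 1) :=
      prefixOf_mem_box (N := k + n + 1) le_rfl fun i hi => hw i (by omega)
    have h1 := hS (k + n) (prefixOf w (k + n + 1)) hbox
    rw [tail_prefixOf] at h1
    have h2 := ih k (fun j => w (j + 1)) fun i hi => hw (i + 1) (by omega)
    have e1 : prefixOf (fun i => (fun j => w (j + 1)) (i + n)) k = prefixOf (fun i => w (i + (n + 1))) k := rfl
    rw [e1] at h2
    have e2 : (k + (n + 1)) = k + n + 1 := rfl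
    rw [e2, sum_range_succ]
    calc |β (k + n + 1) (prefixOf w (k + n + 1)) - β k (prefixOf (fun i => w (i + (n + 1))) k)|
        ≤ |β (k + n + 1) (prefixOf w (k + n + 1)) - β (k + n) (prefixOf (fun i => w (i + 1)) (k + n))|
          + |β (k + n) (prefixOf (fun i => w (i + 1)) (k + n)) - β k (prefixOf (fun i => w (i + (n + 1))) k)| :=
          abs_sub_le _ _ _
      _ ≤ σ (k + n) + ∑ i ∈ range n, σ (k + i) := add_le_add h1 h2
      _ = ∑ i ∈ range n, σ (k + i) + σ (k + n) := add_comm _ _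

/-- **(σ) FROM ℓ¹ CONSECUTIVE SHIFTS ON THE BOXES.**  With `σ ≥ 0` summable: the dock's n-uniform scale-shift modulus (σ)
holds with modulus `k ↦ Σ'_i σ (i + k)` (the tail of `σ` beyond `k`): for all `n, k, w` in the box up to `k + n`,
`|β (k+n) (prefixOf w (k+n)) − β k (prefixOf (fun i => w (i+n)) k)| ≤ Σ'_i σ (i+k)`. [folklore] -/
theorem nullShift_of_summableShift {β : HBeta} {γ : ℝ} {σ : ℕ → ℝ} (hσ : ∀ i, 0 ≤ σ i) (hs : Summable σ)
    (hS : ∀ k (w : Fin (k + 2) → ℝ), w ∈ Box γ (k + 1) → |β (k + 1) w - β k (Fin.tail w)| ≤ σ k) :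
    ∀ n k (w : ℕ → ℝ), (∀ i, i ≤ k + n → 0 < w i ∧ w i ≤ γ) →
      |β (k + n) (prefixOf w (k + n)) - β k (prefixOf (fun i => w (i + n)) k)| ≤ ∑' i, σ (i + k) := by
  intro n k w hw
  refine (nullShift_sum_of_boxShift hS n k w hw).trans ?_
  have hsk : Summable (fun i => σ (i + k)) := (summable_nat_add_iff k).mpr hs
  calc ∑ i ∈ range n, σ (k + i) = ∑ i ∈ range n, σ (i + k) := sum_congr rfl fun i _ => by rw [add_comm]
    _ ≤ ∑' i, σ (i + k) := hsk.sum_le_tsum (range n) fun i _ => hσ _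

/-- The ℓ¹ tail modulus is null: `Σ'_i σ (i + k) → 0` as `k → ∞` (for ANY `σ`; `tendsto_sum_nat_add`). [folklore] -/
theorem tendsto_l1Shift (σ : ℕ → ℝ) : Tendsto (fun k => ∑' i, σ (i + k)) atTop (𝓝 0) :=
  tendsto_sum_nat_add σ

/-- **LEAF T.5♭ UNDER ℓ¹ BOX SHIFTS** (the dock consumes no more than the ℓ¹ road at the β-shift level): the binders of
`NE7PairwiseCouplingDock.couplingGap_tendsto_zero` (p249585) with its n-layer modulus (σ) REPLACED by consecutive shifts
bounded on the boxes by a SUMMABLE `σ_k ≥ 0` give the dock's conclusion: for every block scale `m`,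
`|1∕(g K (K−m))² − 1∕(g (K+n K) (K−m+n K))²| → 0`.  (`NE7PairwiseScaleShift.couplingGap_tendsto_zero_of_scaleShiftRate` is
the geometric case `σ_k = cθ′^k`.)  Bookkeeping over UNPRINTED inputs. [folklore] -/
theorem couplingGap_tendsto_zero_of_summableShift {β : HBeta} {γ b β' C θ q gIR : ℝ} {k₀ : ℕ}
    {Λ : ℕ → ℕ → ℝ} {σ : ℕ → ℝ} (g : ℕ → ℕ → ℝ) (n : ℕ → ℕ)
    (hγ : 0 < γ) (hb : 0 < b) (hθ0 : 0 ≤ θ) (hθ1 : θ < 1) (hC : 0 ≤ C) (hβ' : 0 ≤ β')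
    (hrun : ∀ N, RGEqH N β (g N)) (hbox : ∀ N i, i ≤ N → 0 < g N i ∧ g N i ≤ γ)
    (hpin : ∀ N, g N N = gIR)
    (hL : HistLipschitz Λ γ β) (hΛ : FadingMemory C θ Λ)
    (hlo : EventualLowerH b γ k₀ β) (hup : BetaUpperH β' γ β)
    (hσ : ∀ i, 0 ≤ σ i) (hs : Summable σ)
    (hS : ∀ k (w : Fin (k + 2) → ℝ), w ∈ Box γ (k + 1) → |β (k + 1) w - β k (Fin.tail w)| ≤ σ k)
    (hq : C * ((((k₀ : ℝ) + 1) * γ ^ 3 + 2 * γ / b) / (1 - θ)) ≤ q) (hq1 : q < 1) :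
    ∀ m, Tendsto (fun K => |1 / (g K (K - m)) ^ 2 - 1 / (g (K + n K) (K - m + n K)) ^ 2|)
      atTop (𝓝 0) :=
  NE7PairwiseCouplingDock.couplingGap_tendsto_zero g n hγ hb hθ0 hθ1 hC hβ' hrun hbox hpin hL hΛ hlo hup
    (nullShift_of_summableShift hσ hs hS) (tendsto_l1Shift σ) hq hq1

/-- **THE CONTRAST: NULL CONSECUTIVE SHIFTS DO NOT GIVE (σ).**  The harmonic family `β k _ := Σ_{i<k} 1∕(i+1)` (a
legitimate `HBeta`, constant in the couplings) has consecutive shifts EXACTLY `1∕(k+1) → 0` on every box, yet NO function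
`σ` bounds its n-layer shift `|β (k+n) (…) − β k (…)| = Σ_{i∈[k,k+n)} 1∕(i+1)` uniformly in `n` (already at `k = 0`: the
harmonic numbers are unbounded, `Real.tendsto_sum_range_one_div_nat_succ_atTop`).  So the dock's (σ) is a genuinely two-run
ask: implied by ℓ¹ consecutive shifts (`nullShift_of_summableShift`), NOT by «consecutive → 0» — the β-shift analogue of
`NE7PairwiseCauchy.not_cauchySeq_of_harmonic_steps` and of route ℓ¹'s `NE7MarginalL1Currency.thresholdExact`. [folklore] -/
theorem no_nLayerModulus_of_harmonicShift :
    ∃ β : HBeta,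
      (∀ (γ : ℝ) k (w : Fin (k + 2) → ℝ), w ∈ Box γ (k + 1) →
        |β (k + 1) w - β k (Fin.tail w)| ≤ 1 / ((k : ℝ) + 1)) ∧
      Tendsto (fun k : ℕ => 1 / ((k : ℝ) + 1)) atTop (𝓝 0) ∧
      ¬ ∃ σ : ℕ → ℝ, ∀ n k (w : ℕ → ℝ),
        |β (k + n) (prefixOf w (k + n)) - β k (prefixOf (fun i => w (i + n)) k)| ≤ σ k := by
  refine ⟨fun k _ => ∑ i ∈ range k, (1 : ℝ) / ((i : ℝ) + 1), ?_, tendsto_one_div_add_atTop_nhds_zero_nat, ?_⟩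
  · intro γ k w _
    show |(∑ i ∈ range (k + 1), (1 : ℝ) / ((i : ℝ) + 1)) - ∑ i ∈ range k, (1 : ℝ) / ((i : ℝ) + 1)|
      ≤ 1 / ((k : ℝ) + 1)
    rw [sum_range_succ, add_sub_cancel_left, abs_of_nonneg (by positivity)]
  · rintro ⟨σ, hσ⟩
    -- at `k = 0` the n-layer shift is the harmonic number `H_n`, unbounded in `n`
    have hb : ∀ n, ∑ i ∈ range n, (1 : ℝ) / ((i : ℝ) + 1) ≤ σ 0 := fun n => by
      have h := hσ n 0 (fun _ => 1)
      simp only [Nat.zero_add, sum_range_zero, sub_zero] at h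
      exact (le_abs_self _).trans h
    have hdiv := Real.tendsto_sum_range_one_div_nat_succ_atTop
    rw [tendsto_atTop_atTop] at hdiv
    obtain ⟨N, hN⟩ := hdiv (σ 0 + 1)
    linarith [hN N le_rfl, hb N]

end Summit.QuantumFields.BalabanUV.T4Continuum.NE7PairwiseL1Junction

end
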